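import Mathlib
import Summits.AtomisticToContinuum.FouriersLaw.Theses.EmbeddedDrudeMourre
import Summits.AtomisticToContinuum.FouriersLaw.Theorems.EmbeddedDrudeMourreDrudeDissolutionStubExcursionSecondDifferencePlaneSheetTransversal
import Summits.AtomisticToContinuum.FouriersLaw.Theorems.EmbeddedDrudeMourreMourreDissolutionVelocityShape
import Summits.AtomisticToContinuum.FouriersLaw.Theorems.EmbeddedDrudeMourreDrudeDissolutionStubExcursionSecondDifferenceGradientFloorFar
import Summits.AtomisticToContinuum.FouriersLaw.Theorems.EmbeddedDrudeMourreMourreDissolutionRegularLevels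
import HarnessLib

/-!
# Geometry of the free pair resonance for stub B1b″ of line `kinetic-polymer-gas-on-the-time-axis`:
# the restricted resonant sheet is transversal to every `k₂`-fibre
(crux `EmbeddedDrudeMourre.DrudeDissolution`, item stmt-AtomisticToContinuum-12593; `--supports` file, closes
nothing; lead c13, geometry input (G-T6b, fibre form) of the B1b″ discard bound)

WHAT. For `ω₂ > 0` and the plane restriction of the sheet function
`H₀(k₁,k₂) = 2(ω(k₁)ω(k₂)+ω₂+2)cos((k₁+k₂)/2) − 4cos((k₁−k₂)/2)`:
* `sheetFn_plane_hasDerivAt_snd`: `∂H₀/∂k₂ = E₂(k₁,k₂) := 2ω(k₁)v(k₂)cos((k₁+k₂)/2) − (ω(k₁)ω(k₂)+ω₂+2)sin((k₁+k₂)/2)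
  − 2sin((k₁−k₂)/2)`;
* `sheetFn_plane_deriv_snd_ne_zero`: `H₀(k₁,k₂) = 0 ⇒ E₂(k₁,k₂) ≠ 0` — EVERY zero of `H₀` is transversal to the
  `k₂`-fibre through it (including the triple points): the zero set `{H₀ = 0}` (the closed co-moving curve of the
  exchange plane) is a GRAPH over `k₁` with a uniform fibre-derivative floor, which is the shape in which the
  sublevel-area bound `Area{|H₀| < η} ≤ Cη` (next file) and hence the tube volume `μ{S₁² + A² < η²} ≲ η²` are proved.

HOW. Differentiate the plane identity `sin((k₂−k₁)/2)·H₀ = (v(k₂)−v(k₁))·G`, `G = (ω₁+ω₂)ω₁ω₂ > 0`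
(`sheetFn_plane_identity`) in `k₂` at a zero, where `v(k₂) = v(k₁)`: `sin((k₂−k₁)/2)·E₂ = v′(k₂)·G`. Off the
diagonal (`sin ≠ 0`) a vanishing `E₂` forces `v′(k₂) = 0`, i.e. `k₂ ≡ ±k*` is the unique extremiser of `v`, so
`v(k₁) = v(k₂)` forces `k₁ ≡ k₂` — a contradiction; on the diagonal (`k₂ = k₁ + 2πn`) it forces `cos k₁ = c*` and then
`E₂ = (−1)ⁿ·2 sin k₁ (2cos k₁ − ω₂ − 2) ≠ 0` (`sheetFn_diag_deriv_ne_zero`).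
-/

noncomputable section

open Set Real Topology
open Literature.MathematicalPhysics.KineticTheory
open Literature.MathematicalPhysics.KineticTheory.PhononBoltzmann

namespace Summit.AtomisticToContinuum.FouriersLaw.Theorems.DrudeDissolution.KineticPolymerGasOnTheTimeAxis

/-! ### The fibre derivative -/

/-- **Registered sub-goal `sheetFn_plane_hasDerivAt_snd`: the `k₂`-derivative of the restricted sheet function.**
For `ω₂ > 0`:
`∂/∂k₂ [2(ω(k₁)ω(k₂)+ω₂+2)cos((k₁+k₂)/2) − 4cos((k₁−k₂)/2)] = 2ω(k₁)v(k₂)cos((k₁+k₂)/2) − (ω(k₁)ω(k₂)+ω₂+2)sin((k₁+k₂)/2) − 2sin((k₁−k₂)/2)`.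
[folklore] -/
theorem sheetFn_plane_hasDerivAt_snd :
    ∀ ω₂ : ℝ, 0 < ω₂ → ∀ k₁ k₂ : ℝ,
      HasDerivAt (fun t : ℝ => 2 * (dispersion ω₂ k₁ * dispersion ω₂ t + ω₂ + 2) * Real.cos ((k₁ + t) / 2) -
          4 * Real.cos ((k₁ - t) / 2))
        (2 * dispersion ω₂ k₁ * groupVelocity ω₂ k₂ * Real.cos ((k₁ + k₂) / 2) -
          (dispersion ω₂ k₁ * dispersion ω₂ k₂ + ω₂ + 2) * Real.sin ((k₁ + k₂) / 2) -
          2 * Real.sin ((k₁ - k₂) / 2)) k₂ := by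
  intro ω₂ hω k₁ k₂
  have hd := hasDerivAt_dispersion hω k₂
  have hc1 : HasDerivAt (fun t : ℝ => Real.cos ((k₁ + t) / 2)) (-Real.sin ((k₁ + k₂) / 2) * (1 / 2)) k₂ := by
    have hl : HasDerivAt (fun t : ℝ => (k₁ + t) / 2) (1 / 2) k₂ := by
      have := ((hasDerivAt_id k₂).const_add k₁).div_const 2
      simpa using this
    exact (Real.hasDerivAt_cos ((k₁ + k₂) / 2)).comp k₂ hl
  have hc2 : HasDerivAt (fun t : ℝ => Real.cos ((k₁ - t) / 2)) (-Real.sin ((k₁ - k₂) / 2) * (-1 / 2)) k₂ := by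
    have hl : HasDerivAt (fun t : ℝ => (k₁ - t) / 2) (-1 / 2) k₂ := by
      have := ((hasDerivAt_id k₂).const_sub k₁).div_const 2
      simpa [neg_div] using this
    exact (Real.hasDerivAt_cos ((k₁ - k₂) / 2)).comp k₂ hl
  have hA : HasDerivAt (fun t : ℝ => 2 * (dispersion ω₂ k₁ * dispersion ω₂ t + ω₂ + 2))
      (2 * (dispersion ω₂ k₁ * groupVelocity ω₂ k₂)) k₂ := by
    have := (((hd.const_mul (dispersion ω₂ k₁)).add_const ω₂).add_const 2).const_mul 2
    simpa using this
  have h := (hA.mul hc1).sub (hc2.const_mul 4)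
  refine h.congr_deriv ?_
  ring

/-! ### Every zero is transversal to its fibre -/

/-- Reduction of a real number to the window `(−π, π]` by a `2πℤ`-translation, with the cosine, the group velocity
and the value of `v` at `κ*` transported. [folklore] -/
theorem exists_int_add_mem_Ioc_two_pi (x : ℝ) : ∃ n : ℤ, x + n * (2 * Real.pi) ∈ Ioc (-Real.pi) Real.pi := by
  obtain ⟨n, hn⟩ := exists_int_mem_Icc_sub_two_pi_mul x
  -- `x − 2πn ∈ [−π, π]`; move the endpoint `−π` to `π` if necessary
  by_cases h : x - 2 * Real.pi * n = -Real.pi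
  · refine ⟨-n + 1, ?_⟩
    have : x + ((-n + 1 : ℤ) : ℝ) * (2 * Real.pi) = Real.pi := by push_cast; linarith
    rw [this]
    exact ⟨by linarith [Real.pi_pos], le_rfl⟩
  · refine ⟨-n, ?_⟩
    have e : x + ((-n : ℤ) : ℝ) * (2 * Real.pi) = x - 2 * Real.pi * n := by push_cast; ring
    rw [e]
    exact ⟨lt_of_le_of_ne hn.1 (Ne.symm h), hn.2⟩

/-- **Uniqueness of the co-moving partner at the extremal velocity.** For `ω₂ > 0`: if `v′(k₂) = 0` (i.e.
`cos k₂ = c*`) and `v(k₁) = v(k₂)`, then `k₁ ≡ k₂ (mod 2π)`. (`±κ*` are the unique maximiser / minimiser of the odd,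
`2π`-periodic group velocity.) [folklore] -/
theorem modEq_of_groupVelocity_eq_of_cos_eq_cosKappaStar {ω₂ : ℝ} (hω : 0 < ω₂) {k₁ k₂ : ℝ}
    (hc : Real.cos k₂ = cosKappaStar ω₂) (hv : groupVelocity ω₂ k₁ = groupVelocity ω₂ k₂) :
    ∃ n : ℤ, k₁ - k₂ = 2 * Real.pi * n := by
  have hper := groupVelocity_periodic ω₂
  have hκ := MourreDissolution.velShape_kappaStar_mem hω
  have hcosκ := cos_kappaStar hω
  -- reduce both momenta to `(−π, π]`
  obtain ⟨n₁, h₁⟩ := exists_int_add_mem_Ioc_two_pi k₁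
  obtain ⟨n₂, h₂⟩ := exists_int_add_mem_Ioc_two_pi k₂
  set x₁ := k₁ + n₁ * (2 * Real.pi) with hx₁
  set x₂ := k₂ + n₂ * (2 * Real.pi) with hx₂
  have hv₁ : groupVelocity ω₂ x₁ = groupVelocity ω₂ k₁ := hper.int_mul n₁ k₁
  have hv₂ : groupVelocity ω₂ x₂ = groupVelocity ω₂ k₂ := hper.int_mul n₂ k₂
  have hc₂ : Real.cos x₂ = cosKappaStar ω₂ := by
    rw [hx₂, show k₂ + n₂ * (2 * Real.pi) = k₂ + n₂ * (2 * Real.pi) by rfl, Real.cos_add_int_mul_two_pi, hc]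
  -- `x₂ = ±κ*`
  have hx₂κ : x₂ = kappaStar ω₂ ∨ x₂ = -kappaStar ω₂ := by
    rw [← hcosκ] at hc₂
    obtain ⟨m, hm⟩ := Real.cos_eq_cos_iff.1 hc₂
    have hπ := Real.pi_pos
    -- pin `m = 0` using `x₂ ∈ (−π, π]` and `κ* ∈ (0, π)`
    have hm0 : m = 0 := by
      have hlt : m < 1 := by
        by_contra h
        push Not at h
        have h1 : (1 : ℝ) ≤ m := by exact_mod_cast h
        rcases hm with hm | hm <;> nlinarith [h₂.1, h₂.2, hκ.1, hκ.2]
      have hgt : -1 < m := by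
        by_contra h
        push Not at h
        have h1 : (m : ℝ) ≤ -1 := by exact_mod_cast h
        rcases hm with hm | hm <;> nlinarith [h₂.1, h₂.2, hκ.1, hκ.2]
      omega
    subst hm0
    simp only [Int.cast_zero, mul_zero, zero_mul, zero_add, zero_sub] at hm
    rcases hm with hm | hm
    · left; linarith
    · right; linarith
  -- `x₁ ∈ (−π, π] ⊆ [−π−1, π+1]`
  have hw : x₁ ∈ Icc (-Real.pi - 1) (Real.pi + 1) := ⟨by linarith [h₁.1], by linarith [h₁.2]⟩
  have hvx : groupVelocity ω₂ x₁ = groupVelocity ω₂ x₂ := by rw [hv₁, hv₂, hv]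
  have hx₁₂ : x₁ = x₂ := by
    rcases hx₂κ with e | e
    · -- maximum
      by_contra hne
      rw [e] at hne hvx
      exact (MourreDissolution.velShape_lt_max hω hw hne).ne hvx
    · -- minimum: apply the maximum statement to `−x₁`
      by_contra hne
      have hne' : -x₁ ≠ kappaStar ω₂ := fun h => hne (by rw [e, ← h, neg_neg])
      have hw' : -x₁ ∈ Icc (-Real.pi - 1) (Real.pi + 1) := ⟨by linarith [h₁.2], by linarith [h₁.1]⟩
      have hlt := MourreDissolution.velShape_lt_max hω hw' hne'
      rw [groupVelocity_neg, hvx, e, groupVelocity_neg, neg_neg] at hlt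
      exact lt_irrefl _ hlt
  refine ⟨n₂ - n₁, ?_⟩
  have : k₁ + n₁ * (2 * Real.pi) = k₂ + n₂ * (2 * Real.pi) := hx₁₂
  push_cast
  linarith

/-- **Registered sub-goal `sheetFn_plane_deriv_snd_ne_zero`: every zero of the restricted sheet function is
transversal to its `k₂`-fibre.** For `ω₂ > 0` and all `k₁ k₂`: if
`2(ω(k₁)ω(k₂)+ω₂+2)cos((k₁+k₂)/2) − 4cos((k₁−k₂)/2) = 0` then
`2ω(k₁)v(k₂)cos((k₁+k₂)/2) − (ω(k₁)ω(k₂)+ω₂+2)sin((k₁+k₂)/2) − 2sin((k₁−k₂)/2) ≠ 0`. [folklore] -/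
theorem sheetFn_plane_deriv_snd_ne_zero :
    ∀ ω₂ : ℝ, 0 < ω₂ → ∀ k₁ k₂ : ℝ,
      2 * (dispersion ω₂ k₁ * dispersion ω₂ k₂ + ω₂ + 2) * Real.cos ((k₁ + k₂) / 2) -
          4 * Real.cos ((k₁ - k₂) / 2) = 0 →
      2 * dispersion ω₂ k₁ * groupVelocity ω₂ k₂ * Real.cos ((k₁ + k₂) / 2) -
          (dispersion ω₂ k₁ * dispersion ω₂ k₂ + ω₂ + 2) * Real.sin ((k₁ + k₂) / 2) -
          2 * Real.sin ((k₁ - k₂) / 2) ≠ 0 := by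
  intro ω₂ hω k₁ k₂ hH hE
  have hv : groupVelocity ω₂ k₂ = groupVelocity ω₂ k₁ := groupVelocity_eq_of_sheetFn_plane_eq_zero hω hH
  -- differentiate the plane identity in `k₂`
  have hHd := sheetFn_plane_hasDerivAt_snd ω₂ hω k₁ k₂
  have hS : HasDerivAt (fun t : ℝ => Real.sin ((t - k₁) / 2)) (Real.cos ((k₂ - k₁) / 2) * (1 / 2)) k₂ := by
    have hl : HasDerivAt (fun t : ℝ => (t - k₁) / 2) (1 / 2) k₂ := by
      have := ((hasDerivAt_id k₂).sub_const k₁).div_const 2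
      simpa using this
    exact (Real.hasDerivAt_sin ((k₂ - k₁) / 2)).comp k₂ hl
  have hL := hS.mul hHd
  set G : ℝ → ℝ := fun t => (dispersion ω₂ k₁ + dispersion ω₂ t) * dispersion ω₂ k₁ * dispersion ω₂ t with hGdef
  have hGd : Differentiable ℝ G := by
    have hd : Differentiable ℝ (dispersion ω₂) := fun k => (hasDerivAt_dispersion hω k).differentiableAt
    rw [hGdef]
    exact ((hd.const_add _).mul_const _ |>.mul hd)
  have hG' : HasDerivAt G (deriv G k₂) k₂ := (hGd k₂).hasDerivAt
  have hD : HasDerivAt (fun t : ℝ => groupVelocity ω₂ t - groupVelocity ω₂ k₁)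
      (deriv (groupVelocity ω₂) k₂) k₂ := by
    have := (hasDerivAt_groupVelocity hω k₂).sub_const (groupVelocity ω₂ k₁)
    rw [(hasDerivAt_groupVelocity hω k₂).deriv]
    exact this
  have hR := hD.mul hG'
  -- the two sides are the same function of `k₂`
  have hfun : ((fun t : ℝ => Real.sin ((t - k₁) / 2)) * fun t : ℝ =>
      (2 * (dispersion ω₂ k₁ * dispersion ω₂ t + ω₂ + 2) * Real.cos ((k₁ + t) / 2) - 4 * Real.cos ((k₁ - t) / 2))) =
      ((fun t : ℝ => groupVelocity ω₂ t - groupVelocity ω₂ k₁) * G) := by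
    funext t
    simp only [Pi.mul_apply, hGdef]
    exact sheetFn_plane_identity ω₂ hω k₁ t
  rw [hfun] at hL
  have huniq := hL.unique hR
  -- evaluate at the zero: `H₀ = 0`, `E₂ = 0`, `v(k₂) − v(k₁) = 0`
  rw [hH, hE, hv, sub_self] at huniq
  simp only [mul_zero, zero_mul, add_zero] at huniq
  -- `huniq : 0 = v′(k₂) · G k₂`
  have hGpos : 0 < G k₂ := by
    rw [hGdef]
    exact mul_pos (mul_pos (add_pos (dispersion_pos hω k₁) (dispersion_pos hω k₂)) (dispersion_pos hω k₁))
      (dispersion_pos hω k₂)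
  have hv' : deriv (groupVelocity ω₂) k₂ = 0 := by
    rcases mul_eq_zero.1 huniq.symm with h | h
    · exact h
    · exact absurd h hGpos.ne'
  have hc2 : Real.cos k₂ = cosKappaStar ω₂ := (deriv_groupVelocity_eq_zero_iff_cos hω k₂).1 hv'
  -- hence `k₁ ≡ k₂`, and the point is a triple point on the diagonal
  obtain ⟨n, hn⟩ := modEq_of_groupVelocity_eq_of_cos_eq_cosKappaStar hω hc2 hv.symm
  have hk₁ : k₁ = k₂ + 2 * Real.pi * n := by linarith
  have hc1 : Real.cos k₁ = cosKappaStar ω₂ := by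
    rw [hk₁, show k₂ + 2 * Real.pi * n = k₂ + n * (2 * Real.pi) by ring, Real.cos_add_int_mul_two_pi, hc2]
  -- explicit value of `E₂` there: `(−1)ⁿ · 2 sin k₂ (2cos k₂ − ω₂ − 2)`
  obtain ⟨-, -, hne⟩ := sheetFn_diag_deriv_ne_zero ω₂ hω k₂ hc2
  have hω12 : dispersion ω₂ k₁ = dispersion ω₂ k₂ := MourreDissolution.regularLevels_dispersion_eq (by rw [hc1, hc2])
  have ea : (k₁ + k₂) / 2 = k₂ + n * Real.pi := by rw [hk₁]; ring
  have eb : (k₁ - k₂) / 2 = n * Real.pi := by rw [hk₁]; ring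
  rw [ea, eb, Real.cos_add_int_mul_pi, Real.sin_add_int_mul_pi, hω12,
    show (n : ℝ) * Real.pi = 0 + n * Real.pi by ring, Real.sin_add_int_mul_pi, Real.sin_zero, mul_zero,
    mul_zero, sub_zero] at hE
  unfold groupVelocity at hE
  have hd2 := dispersion_pos hω k₂
  have hsq := dispersion_sq hω.le k₂
  -- `hE : 2 ω (sin/ω) ((−1)ⁿ cos) − (ω² + ω₂ + 2)((−1)ⁿ sin) = 0`
  have key : (-1 : ℝ) ^ n * (2 * Real.sin k₂ * (2 * Real.cos k₂ - ω₂ - 2)) = 0 := by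
    have e1 : 2 * dispersion ω₂ k₂ * (Real.sin k₂ / dispersion ω₂ k₂) = 2 * Real.sin k₂ := by
      field_simp
    rw [e1] at hE
    have e2 : dispersion ω₂ k₂ * dispersion ω₂ k₂ = ω₂ + 2 - 2 * Real.cos k₂ := by rw [← sq, hsq]; ring
    rw [e2] at hE
    linear_combination hE
  have hpow : ((-1 : ℝ) ^ n) ≠ 0 := zpow_ne_zero _ (by norm_num)
  have h2 : 2 * Real.sin k₂ * (2 * Real.cos k₂ - ω₂ - 2) = 0 := (mul_eq_zero.1 key).resolve_left hpow
  apply hne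
  linear_combination 2 * h2

end Summit.AtomisticToContinuum.FouriersLaw.Theorems.DrudeDissolution.KineticPolymerGasOnTheTimeAxis

end
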